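import Literature.Analysis.FluidPDE.TorusTwoBackgroundGevreySmoothing
import Literature.Analysis.FunctionSpaces.TorusClassicalNSUniqueness
import HarnessLib

/-!
# Gevrey smoothing of the difference of two Navier–Stokes solutions along uniformly Gevrey windows

Analysis/FluidPDE support file (theorems only; no definitions, no named facts), a corollary of the
two-background Gevrey smoothing `Torus.twoBackground_gevrey_of_gevreyBound`
(`TorusTwoBackgroundGevreySmoothing.lean`; the two-background linear twin of Foias–Temam,
J. Funct. Anal. 87 (1989), Thm 1.1).  For two classical solutions `(u₁, p₁)`, `(u₂, p₂)` of the
Navier–Stokes system on `[a, a + τ] × T^d` with the same viscosity `ν > 0` and the same force, both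
with zero-mean slices and both UNIFORMLY GEVREY on the window
(`∑_{k∈S} e^{2σ₀|k|} ‖ûⱼ(t, k)‖² ≤ C₀`), the difference `δ = u₁ − u₂` solves the two-background
linear equation `∂ₜδ + (u₁·∇)δ + (δ·∇)u₂ = νΔδ − ∇(p₁ − p₂)`
(`Torus.IsClassicalNSSolutionOn.timeDerivWithin_sub_eq`), so its final slice is Gevrey with a
constant LINEAR in the initial `H¹` energy of the difference:

  `∑_{k∈S} e^{2σ|k|} ‖δ̂(a + τ, k)‖² ≤ C (∫ ‖δ(a)‖² + ‖∇δ(a)‖₂²)`,   `σ > 0`, `C = C(ν, σ₀, C₀, τ, d)`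

(`Torus.IsClassicalNSSolutionOn.gevrey_sub_of_gevreyBound`).  This is the LIPSCHITZ DEPENDENCE IN
GEVREY NORM of bounded-enstrophy Navier–Stokes trajectories on their `H¹` data after a warm-up (the
backgrounds are uniformly Gevrey there by Foias–Temam smoothing), the input of the `y`-differentiability
of the time-derivative field of the smooth model of the NS semiflow.

## Mathlib / tree search

Tree (reused): `Torus.twoBackground_gevrey_of_gevreyBound`, `Torus.IsClassicalNSSolutionOn.timeDerivWithin_sub_eq`,
`Torus.laplacian_sub`, `Torus.divergence_sub`, `IsSmoothSpaceTimeOn.sub`.  Searched `gevrey_sub`,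
`Gevrey.*difference`, `sub.*gevreyBound` under `FluidPDE/`, `FunctionSpaces/`: only the `H¹`-level continuous
dependence `Torus.IsClassicalNSSolutionOn.h1_sub_le_mul_exp` (`TorusClassicalNSDifferenceSmoothing`).

## References

* C. Foias, R. Temam, *Gevrey class regularity for the solutions of the Navier–Stokes equations*,
  J. Funct. Anal. 87 (1989) 359–369, Thm 1.1, Lemma 2.1. [FoiasTemam1989]
* P. Constantin, C. Foias, *Navier–Stokes Equations*, Univ. Chicago Press 1988, Ch. 14 (the equation of the
  difference of two solutions). [ConstantinFoiasNSE1988]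
-/

noncomputable section

open _root_.MeasureTheory Set Filter Function UnitAddTorus
open scoped Topology BigOperators

namespace Literature.Analysis.FluidPDE

namespace Torus

open Literature.Analysis.FunctionSpaces Literature.Analysis.FunctionSpaces.Torus

variable {d : Type*} [Fintype d] [DecidableEq d]

/-- **Gevrey smoothing of the difference of two Navier–Stokes solutions along uniformly Gevrey windows**
(Lipschitz dependence in Gevrey norm on the `H¹` data).  For `ν > 0`, a Gevrey radius `σ₀ > 0` and level
`C₀` and a window length `τ > 0` there are `σ > 0` and `C` such that: for two classical solutions
`(u₁, p₁)`, `(u₂, p₂)` of NS_ν with the same force on `[a, a + τ] × T^d`, with zero-mean slices and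
`∑_{k∈S} e^{2σ₀|k|} ‖ûⱼ(t, k)‖² ≤ C₀` for all `t ∈ [a, a + τ]`, all finite `S`, `j = 1, 2`, the difference
satisfies `∑_{k∈S} e^{2σ|k|} ‖𝓕(u₁(a + τ) − u₂(a + τ))(k)‖² ≤ C (∫ ‖(u₁ − u₂)(a)‖² + ‖∇(u₁ − u₂)(a)‖₂²)` for
every finite `S` (the difference solves `∂ₜδ + (u₁·∇)δ + (δ·∇)u₂ = νΔδ − ∇(p₁ − p₂)`,
`Torus.IsClassicalNSSolutionOn.timeDerivWithin_sub_eq`, to which `Torus.twoBackground_gevrey_of_gevreyBound`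
applies). [cite: FoiasTemam1989, Thm 1.1 and Lemma 2.1] -/
theorem IsClassicalNSSolutionOn.gevrey_sub_of_gevreyBound {ν : ℝ} (hν : 0 < ν) (σ₀ C₀ τ : ℝ) (hσ₀ : 0 < σ₀)
    (hτ : 0 < τ) :
    ∃ σ : ℝ, 0 < σ ∧ ∃ C : ℝ, ∀ {a : ℝ} {f u₁ u₂ : ℝ → UnitAddTorus d → EuclideanSpace ℝ d}
      {p₁ p₂ : ℝ → UnitAddTorus d → ℝ},
      IsClassicalNSSolutionOn (Icc a (a + τ)) ν f u₁ p₁ → IsClassicalNSSolutionOn (Icc a (a + τ)) ν f u₂ p₂ →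
      (∀ t ∈ Icc a (a + τ), HasZeroMean (u₁ t)) → (∀ t ∈ Icc a (a + τ), HasZeroMean (u₂ t)) →
      (∀ t ∈ Icc a (a + τ), ∀ S : Finset (d → ℤ), ∑ k ∈ S, Real.exp (2 * σ₀ * Real.sqrt (freqNormSq k)) *
        ‖mFourierCoeff (EuclideanSpace.complexify ∘ u₁ t) k‖ ^ 2 ≤ C₀) →
      (∀ t ∈ Icc a (a + τ), ∀ S : Finset (d → ℤ), ∑ k ∈ S, Real.exp (2 * σ₀ * Real.sqrt (freqNormSq k)) *
        ‖mFourierCoeff (EuclideanSpace.complexify ∘ u₂ t) k‖ ^ 2 ≤ C₀) →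
      ∀ S : Finset (d → ℤ), ∑ k ∈ S, Real.exp (2 * σ * Real.sqrt (freqNormSq k)) *
        ‖mFourierCoeff (EuclideanSpace.complexify ∘ fun x => u₁ (a + τ) x - u₂ (a + τ) x) k‖ ^ 2 ≤
          C * ((∫ x, ‖u₁ a x - u₂ a x‖ ^ 2) + gradNormSq (fun x => u₁ a x - u₂ a x)) := by
  obtain ⟨σ, hσ, C, hC⟩ := twoBackground_gevrey_of_gevreyBound (d := d) hν σ₀ C₀ τ hσ₀ hτ
  refine ⟨σ, hσ, C, fun {a f u₁ u₂ p₁ p₂} h₁ h₂ hz₁ hz₂ hgev₁ hgev₂ S => ?_⟩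
  have hab : a < a + τ := by linarith
  -- the difference and its equation
  have hδ : IsSmoothSpaceTimeOn (Icc a (a + τ)) (fun s y => u₁ s y - u₂ s y) :=
    h₁.smooth_velocity.sub h₂.smooth_velocity
  have hπ : IsSmoothSpaceTimeOn (Icc a (a + τ)) (fun s y => p₁ s y - p₂ s y) :=
    h₁.smooth_pressure.sub h₂.smooth_pressure
  have hδdiv : ∀ s ∈ Icc a (a + τ), IsDivFree (fun y => u₁ s y - u₂ s y) := by
    intro s hs x
    have hu₁ : IsSmooth (u₁ s) := h₁.smooth_velocity.isSmooth_slice hs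
    have hu₂ : IsSmooth (u₂ s) := h₂.smooth_velocity.isSmooth_slice hs
    rw [show (fun y => u₁ s y - u₂ s y) = u₁ s - u₂ s from rfl,
      divergence_sub (hu₁.isContDiff (by simp)) (hu₂.isContDiff (by simp)), h₁.divFree s hs x,
      h₂.divFree s hs x, sub_zero]
  have hδz : ∀ s ∈ Icc a (a + τ), HasZeroMean (fun y => u₁ s y - u₂ s y) := by
    intro s hs
    unfold HasZeroMean
    rw [integral_sub (h₁.smooth_velocity.isSmooth_slice hs).integrable
      (h₂.smooth_velocity.isSmooth_slice hs).integrable, hz₁ s hs, hz₂ s hs, sub_zero]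
  have heq : ∀ s ∈ Icc a (a + τ), ∀ x, timeDerivWithin (Icc a (a + τ)) (fun s y => u₁ s y - u₂ s y) s x +
      Torus.convect (u₁ s) (fun y => u₁ s y - u₂ s y) x + Torus.convect (fun y => u₁ s y - u₂ s y) (u₂ s) x =
      ν • Torus.laplacian (fun y => u₁ s y - u₂ s y) x - Torus.gradient (fun y => p₁ s y - p₂ s y) x := by
    intro s hs x
    have hu₁ : IsSmooth (u₁ s) := h₁.smooth_velocity.isSmooth_slice hs
    have hu₂ : IsSmooth (u₂ s) := h₂.smooth_velocity.isSmooth_slice hs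
    have hL : laplacian (fun y => u₁ s y - u₂ s y) x = laplacian (u₁ s) x - laplacian (u₂ s) x := by
      rw [show (fun y => u₁ s y - u₂ s y) = u₁ s - u₂ s from rfl, laplacian_sub hu₁ hu₂, Pi.sub_apply]
    rw [h₁.timeDerivWithin_sub_eq h₂ hab hs x, hL]
    abel
  exact hC h₁.smooth_velocity h₁.divFree h₂.smooth_velocity hgev₁ hgev₂ hδ hπ hδdiv hδz heq S

end Torus

end Literature.Analysis.FluidPDE

end
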